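import Literature.NumberTheory.Automorphic.JPSSGlobalIntegralQuotientUnfolding
import Literature.NumberTheory.Automorphic.JPSSCornerWhittakerUnfolding
import Literature.NumberTheory.Automorphic.RatPointsCoveringWeights
import Literature.NumberTheory.Automorphic.RankinSelbergQuotientUnfolding
import Literature.NumberTheory.Automorphic.NormOneTorusAdelicCompact
import Literature.NumberTheory.Automorphic.RankinSelbergLocalGLOne
import HarnessLib

/-!
# The global Hecke integral of a cusp form on `GL₂` unfolded to the ideles:
# `I(s; φ, 𝟙) = C ∫_{𝕀_K} W_φ(diag(a,1)) |a|^{s-1/2} d×a`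
# (Jacquet–Langlands (1970), §11 p. 171; Cogdell (2004), §2.2 for `(n, m) = (2, 1)`)

Topic `NumberTheory/Automorphic`; namespace `Literature.NumberTheory.Automorphic`. Theorems only (no
definition, no named fact, no instance). The case `(n, m) = (2, 1)`, `φ' = 𝟙`, of the unfolding of the
corner integral `I(s; φ, φ') = jpssIntegral` of the tree (`JPSSGlobalIntegral`): combining

* `exists_jpssIntegral_eq_mul_integral_coveringWeight` (`JPSSGlobalIntegralQuotientUnfolding`:
  `I(s; φ, φ') = C ∫_{GL₁(𝔸)} Φ(diag(g,1)) Φ'(g) |det g|^{s-1/2} β(g) dν(g)` for a `GL₁(K)`-covering weight `β`),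
* `integral_whittakerDepth_glCorner_mul_eq` (`JPSSCornerWhittakerUnfolding`: inserting the Fourier–Whittaker
  expansion, `∫ W_Φ(diag(g,1)) Θ(g) dν = ∫ Φ(diag(g,1)) Θ(g) β(g) dν`, `N₁ = 1` so `β' ≡ 1`), and
* the topological group isomorphism `det : GL₁(𝔸_K) ≃ 𝕀_K` (transport of the Haar measure `ν`),

we PROVE:

* `isRapidlyDecreasingGL_of_fin_one` — on `GL₁` every function is rapidly decreasing (no simple root);
* `glCorner_fin_one_eq_glDiagonal`, `coe_glAbsDet_eq_ideleNorm` — `diag(g, 1) = diag(det g, 1)` and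
  `|det g|_𝔸 = ‖det g‖` (bookkeeping between the corner currency and the idelic one);
* `isHaarMeasure_map_det_fin_one`, `integral_map_det_fin_one`, `lintegral_map_det_fin_one` — transport
  of Haar measure and of integrals along `det : GL₁(𝔸_K) → 𝕀_K`;
* `exists_jpssIntegral_two_one_eq_mul_integral_idele` (**main**) — for an automorphic measure `μ'` on
  `X₁ = GL₁(𝔸_K) ⧸ A_G GL₁(K)` and a Haar measure `ν` on `GL₁(𝔸_K)` there is `C > 0` such that for every
  `φ` on `X₂` whose classical function `Φ = invQuot φ` is a cusp form (`IsCuspFormGL`) and every `s` at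
  which the unfolded integrand is absolutely integrable,

    `jpssIntegral (1<2) μ' φ 𝟙 s = C · ∫_{𝕀_K} W_Φ(diag(a,1)) ‖a‖^{s-1/2} d(det_* ν)(a)`,

  `W_Φ = whittakerDepth 0 Φ` the global `ψ`-Whittaker function. With
  `integral_heckeIntegrand_pureTensor_eq_mul_tprod` (`HeckeIntegralPureTensorEuler`) this is
  `Ψ(s, φ) = ∏_v Ψ(s, W_v)`, Jacquet–Langlands (1970), p. 171, for pure tensors, the left side being entire
  (`differentiable_jpssIntegral_of_isCuspFormGL`).

## References

* H. Jacquet, R. P. Langlands, *Automorphic Forms on GL(2)*, LNM 114 (1970), §11 pp. 170–171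
  [JacquetLanglands1970].
* J. W. Cogdell, *Lectures on L-functions, converse theorems, and functoriality for GL_n* (2004), §2.2–2.3
  [CogdellAnalyticTheory2004].
-/

noncomputable section

open MeasureTheory Measure NumberField IsDedekindDomain Matrix Set Filter Topology
open Literature.MeasureTheory.Group
open Literature.NumberTheory.GaloisRepresentations (ideleGroup)
open scoped MatrixGroups ENNReal NNReal

namespace Literature.NumberTheory.Automorphic

variable {K : Type} [Field K] [NumberField K]

local notation "𝔸" => AdeleRing (𝓞 K) K

/-! ### 1. Bookkeeping -/

section Bookkeeping

/-- **On `GL₁` every function is rapidly decreasing**: there is no simple root, the condition of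
`IsRapidlyDecreasingGL` is vacuous. [folklore] -/
theorem isRapidlyDecreasingGL_of_fin_one (Φ : GL (Fin 1) 𝔸 → ℂ) : IsRapidlyDecreasingGL 1 K Φ := by
  intro Ω _ t _ B _
  refine ⟨0, fun a _ _ y _ i j hij => ?_⟩
  exact absurd hij (by omega)

/-- `diag(g, 1) = diag(det g, 1)` for `g ∈ GL₁`. [folklore] -/
theorem glCorner_fin_one_eq_glDiagonal {R : Type*} [CommRing R] (g : GL (Fin 1) R) :
    glCorner R one_le_two g = glDiagonal 2 R ![Matrix.GeneralLinearGroup.det g, 1] :=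
  glCorner_one_eq_diagGL2 one_le_two g

/-- `|det g|_𝔸 = ‖det g‖` (definitional). [folklore] -/
theorem coe_glAbsDet_eq_ideleNorm {n : ℕ} (g : GL (Fin n) 𝔸) :
    ((glAbsDet n K g : ℝ≥0ˣ) : ℝ≥0) = IdeleClassGroup.ideleNorm K (Matrix.GeneralLinearGroup.det g) := rfl

/-- A `1 × 1` invertible matrix is the diagonal matrix of its determinant (any commutative ring).
[folklore] -/
theorem glDiagonal_det_eq_of_fin_one {R : Type*} [CommRing R] (g : GL (Fin 1) R) :
    glDiagonal 1 R (fun _ => Matrix.GeneralLinearGroup.det g) = g := by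
  refine Units.ext (Matrix.ext fun i j => ?_)
  have hi : i = 0 := Subsingleton.elim i 0
  have hj : j = 0 := Subsingleton.elim j 0
  subst hi; subst hj
  rw [coe_glDiagonal, Matrix.diagonal_apply_eq, Matrix.GeneralLinearGroup.val_det_apply,
    Matrix.det_fin_one]

/-- `det (diag a) = a` on `GL₁` (any commutative ring). [folklore] -/
theorem det_glDiagonal_of_fin_one {R : Type*} [CommRing R] (a : Rˣ) :
    Matrix.GeneralLinearGroup.det (glDiagonal 1 R fun _ => a) = a := by
  refine Units.ext ?_
  rw [Matrix.GeneralLinearGroup.val_det_apply, coe_glDiagonal, Matrix.det_diagonal, Fin.prod_univ_one]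

end Bookkeeping

/-! ### 2. Transport along `det : GL₁(𝔸_K) ≃ 𝕀_K` -/

section Transport

variable [MeasurableSpace (GL (Fin 1) (AdeleRing (𝓞 K) K))] [BorelSpace (GL (Fin 1) (AdeleRing (𝓞 K) K))]
  [MeasurableSpace (ideleGroup K)] [BorelSpace (ideleGroup K)]

omit [MeasurableSpace (GL (Fin 1) (AdeleRing (𝓞 K) K))] [BorelSpace (GL (Fin 1) (AdeleRing (𝓞 K) K))]
  [MeasurableSpace (ideleGroup K)] [BorelSpace (ideleGroup K)] in
/-- `det : GL₁(𝔸_K) → 𝕀_K` is continuous with continuous inverse `a ↦ diag(a)`. [folklore] -/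
theorem continuous_glDiagonal_fin_one : Continuous fun a : ideleGroup K => glDiagonal 1 𝔸 fun _ => a :=
  (continuous_glDiagonal (n := 1) 𝔸).comp (continuous_pi fun _ => continuous_id)

/-- **`det_* ν` is a Haar measure on `𝕀_K`** for a Haar measure `ν` on `GL₁(𝔸_K)` (`det` is an isomorphism
of topological groups). [folklore] -/
theorem isHaarMeasure_map_det_fin_one (ν : Measure (GL (Fin 1) 𝔸)) [IsHaarMeasure ν] :
    IsHaarMeasure (ν.map (Matrix.GeneralLinearGroup.det : GL (Fin 1) 𝔸 →* ideleGroup K)) := by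
  set d : ideleGroup K →* GL (Fin 1) 𝔸 :=
    (glDiagonal 1 𝔸).comp ⟨⟨fun a _ => a, rfl⟩, fun _ _ => rfl⟩ with hd
  have hd_apply : ∀ a, d a = glDiagonal 1 𝔸 (fun _ => a) := fun a => rfl
  set e : GL (Fin 1) 𝔸 ≃* ideleGroup K :=
    MonoidHom.toMulEquiv Matrix.GeneralLinearGroup.det d
      (MonoidHom.ext fun g => by
        change d (Matrix.GeneralLinearGroup.det g) = g
        rw [hd_apply, glDiagonal_det_eq_of_fin_one])
      (MonoidHom.ext fun a => by
        change Matrix.GeneralLinearGroup.det (d a) = a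
        rw [hd_apply, det_glDiagonal_of_fin_one]) with he
  have h := e.isHaarMeasure_map ν Matrix.GeneralLinearGroup.continuous_det
    (by
      change Continuous fun a : ideleGroup K => d a
      simp_rw [hd_apply]
      exact continuous_glDiagonal_fin_one)
  exact h

omit [BorelSpace (GL (Fin 1) (AdeleRing (𝓞 K) K))] [BorelSpace (ideleGroup K)] in
/-- Transport of Bochner integrals along `det`. [folklore] -/
theorem integral_map_det_fin_one (ν : Measure (GL (Fin 1) 𝔸)) {E' : Type*} [NormedAddCommGroup E']
    [NormedSpace ℝ E'] {f : ideleGroup K → E'}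
    (hf : AEStronglyMeasurable f (ν.map (Matrix.GeneralLinearGroup.det : GL (Fin 1) 𝔸 →* ideleGroup K)))
    (hdet : Measurable (Matrix.GeneralLinearGroup.det : GL (Fin 1) 𝔸 →* ideleGroup K)) :
    ∫ a, f a ∂(ν.map (Matrix.GeneralLinearGroup.det : GL (Fin 1) 𝔸 →* ideleGroup K)) =
      ∫ g, f (Matrix.GeneralLinearGroup.det g) ∂ν :=
  integral_map hdet.aemeasurable hf

omit [BorelSpace (GL (Fin 1) (AdeleRing (𝓞 K) K))] [BorelSpace (ideleGroup K)] in
/-- Transport of lower Lebesgue integrals along `det`. [folklore] -/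
theorem lintegral_map_det_fin_one (ν : Measure (GL (Fin 1) 𝔸)) {f : ideleGroup K → ℝ≥0∞} (hf : Measurable f)
    (hdet : Measurable (Matrix.GeneralLinearGroup.det : GL (Fin 1) 𝔸 →* ideleGroup K)) :
    ∫⁻ a, f a ∂(ν.map (Matrix.GeneralLinearGroup.det : GL (Fin 1) 𝔸 →* ideleGroup K)) =
      ∫⁻ g, f (Matrix.GeneralLinearGroup.det g) ∂ν :=
  lintegral_map hf hdet

end Transport

/-! ### 3. The unfolded Hecke integral -/

section Main

-- the house Borel structures: `adelicBorel` on `(AdelicGroupData.gl n K).Adelic` (the currency of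
-- `JPSSGlobalIntegralQuotientUnfolding`) and `glAdeleBorel` on `GL_n(𝔸_K)` (the currency of
-- `JPSSCornerWhittakerUnfolding` and of the Whittaker transform); both are `borel _`.
attribute [local instance] adelicBorel borelSpace_adelic locallyCompactSpace_adelic
  secondCountableTopology_gl_adelic glAdeleBorel borelSpace_glAdele

variable [MeasurableSpace (ideleGroup K)] [BorelSpace (ideleGroup K)]

omit [MeasurableSpace (ideleGroup K)] [BorelSpace (ideleGroup K)] in
/-- The `GL₁(K)`-covering weights of `RatPointsCoveringWeights` are covering weights for the arithmetic
subgroup of the adelic datum `gl 1 K` (`ratPoints ⊤ = GL₁(K)`). [folklore] -/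
theorem isCoveringWeight_arithmeticSubgroup_of_ratPoints {β : GL (Fin 1) 𝔸 → ℝ≥0∞}
    (hβ : IsCoveringWeight ↥(ratPoints (n := 1) (K := K) (⊤ : Subgroup (GL (Fin 1) K))) β) :
    IsCoveringWeight ↥(AdelicGroupData.gl 1 K).arithmeticSubgroup
      (fun g : (AdelicGroupData.gl 1 K).Adelic => β g) := by
  refine ⟨hβ.1, fun x => ?_⟩
  have h := hβ.2 x
  rw [coveringSum_apply] at h ⊢
  rw [← h]
  set e : ↥(ratPoints (n := 1) (K := K) (⊤ : Subgroup (GL (Fin 1) K))) ≃*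
      ↥(AdelicGroupData.gl 1 K).arithmeticSubgroup :=
    MulEquiv.subgroupCongr (ratPoints_top_eq_arithmeticSubgroup (n := 1) (K := K)) with he
  rw [← e.toEquiv.tsum_eq]
  rfl

/-- **MAIN. The global Hecke integral of a `GL₂` cusp form, unfolded to the ideles** (Jacquet–Langlands
(1970), p. 171: "`∫_{k×\𝕀} φ(diag(a,1)) |a|^{s-1/2} d×a = ∫_𝕀 W_φ(diag(a,1)) |a|^{s-1/2} d×a = Ψ(s, W_φ)`";
Cogdell (2004), §2.2 for `(n, m) = (2, 1)`). For an automorphic measure `μ'` on `X₁` and a Haar measure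
`ν` on `GL₁(𝔸_K)` there is `C > 0` such that: for every `φ` on `X₂ = GL₂(𝔸_K) ⧸ A_G GL₂(K)` whose classical
function `Φ = invQuot φ` is a cusp form and every `s ∈ ℂ` at which
`∫_{𝕀_K} ‖W_Φ(diag(a,1)) ‖a‖^{s-1/2}‖ d(det_* ν) < ∞`,

  `jpssIntegral (1<2) μ' φ 𝟙 s = C · ∫_{𝕀_K} W_Φ(diag(a,1)) ‖a‖^{s-1/2} d(det_* ν)(a)`.

[cite: JacquetLanglands1970, §11 p. 171] [cite: CogdellAnalyticTheory2004, §2.2 (PDF p. 182)] -/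
theorem exists_jpssIntegral_two_one_eq_mul_integral_idele
    (μ' : Measure (AdelicGroupData.gl 1 K).automorphicQuotient) [(AdelicGroupData.gl 1 K).IsAutomorphicMeasure μ']
    (ν : Measure (GL (Fin 1) 𝔸)) [ν.IsHaarMeasure] :
    ∃ C : ℝ, 0 < C ∧
      ∀ {hcpt : isCompact_glFiniteIntegralLevel 2 K} (φ : (AdelicGroupData.gl 2 K).automorphicQuotient → ℂ),
        IsCuspFormGL 2 K hcpt (invQuot (AdelicGroupData.gl 2 K) φ) →
      ∀ s : ℂ,
        ∫⁻ a, ‖whittakerDepth 0 (invQuot (AdelicGroupData.gl 2 K) φ) (glDiagonal 2 𝔸 ![a, 1]) *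
            ((IdeleClassGroup.ideleNorm K a : ℝ) : ℂ) ^ (s - 1 / 2)‖ₑ
          ∂(ν.map (Matrix.GeneralLinearGroup.det : GL (Fin 1) 𝔸 →* ideleGroup K)) < ∞ →
        jpssIntegral Nat.one_lt_two μ' φ (fun _ => 1) s =
          (C : ℂ) * ∫ a, whittakerDepth 0 (invQuot (AdelicGroupData.gl 2 K) φ) (glDiagonal 2 𝔸 ![a, 1]) *
            ((IdeleClassGroup.ideleNorm K a : ℝ) : ℂ) ^ (s - 1 / 2)
            ∂(ν.map (Matrix.GeneralLinearGroup.det : GL (Fin 1) 𝔸 →* ideleGroup K)) := by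
  classical
  -- `ν` read on the adelic datum `gl 1 K`
  haveI hνH : @Measure.IsHaarMeasure (AdelicGroupData.gl 1 K).Adelic _ _ _ (show Measure (AdelicGroupData.gl 1 K).Adelic from ν) :=
    ‹ν.IsHaarMeasure›
  obtain ⟨C, hC, hmain⟩ := exists_jpssIntegral_eq_mul_integral_coveringWeight (n := 2) (m := 1) (K := K)
    Nat.one_pos Nat.one_lt_two μ' (show Measure (AdelicGroupData.gl 1 K).Adelic from ν)
  -- a `GL₁(K)`-covering weight
  obtain ⟨β, hβ⟩ := exists_isCoveringWeight_ratPoints (n := 1) (K := K) (⊤ : Subgroup (GL (Fin 1) K))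
  have hβ' := isCoveringWeight_arithmeticSubgroup_of_ratPoints hβ
  refine ⟨C, hC, fun {hcpt} φ hφ s hint => ?_⟩
  set Φ : GL (Fin 2) 𝔸 → ℂ := invQuot (AdelicGroupData.gl 2 K) φ with hΦ
  -- the data of `exists_jpssIntegral_eq_mul_integral_coveringWeight`
  have hφc : Continuous Φ := hφ.1.continuous_gl
  have hφd : IsRapidlyDecreasingGL 2 K Φ :=
    hφ.isRapidlyDecreasingGL_of_center' fun z hz g => invQuot_mul_left _ φ (Subgroup.mem_sup_left hz) g
  have h1c : Continuous (invQuot (AdelicGroupData.gl 1 K) (fun _ : (AdelicGroupData.gl 1 K).automorphicQuotient => (1 : ℂ))) :=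
    continuous_const
  have h1d : IsRapidlyDecreasingGL 1 K (invQuot (AdelicGroupData.gl 1 K)
      (fun _ : (AdelicGroupData.gl 1 K).automorphicQuotient => (1 : ℂ))) :=
    isRapidlyDecreasingGL_of_fin_one _
  obtain ⟨-, hI⟩ := hmain φ hφc hφd (fun _ => 1) h1c h1d _ hβ' s
  refine hI.trans ?_
  congr 1
  -- the factor `Θ(g) = |det g|^{s-1/2}` (Borel, left `GL₁(K)`-invariant)
  set Θ : GL (Fin 1) 𝔸 → ℂ := fun g => ((((glAbsDet 1 K g : ℝ≥0ˣ) : ℝ≥0) : ℝ) : ℂ) ^ (s - 1 / 2) with hΘ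
  have hΘc : Continuous Θ := by
    refine (Complex.continuous_ofReal.comp (continuous_glAbsDet_real 1 K)).cpow continuous_const fun g => ?_
    exact Or.inl (by
      rw [Function.comp_apply, Complex.ofReal_re]
      exact glAbsDet_real_pos g)
  have hΘK : ∀ (γ₀ : GL (Fin 1) K) (x : GL (Fin 1) 𝔸), Θ (ratGL K γ₀ * x) = Θ x := by
    intro γ₀ x
    simp only [hΘ, map_mul]
    rw [glAbsDet_eq_one_of_mem_rationalPointsGL ⟨γ₀, rfl⟩, one_mul]
  -- the cusp form at the level of `integral_whittakerDepth_glCorner_mul_eq`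
  have hφ' : IsCuspFormGL (1 + 1) K (isCompact_glFiniteIntegralLevel_holds (1 + 1) K) Φ := hφ
  -- the trivial `N₁(K)`-covering weight `β' ≡ 1`
  have hβ1 : ∀ x : GL (Fin 1) 𝔸, coveringSum ↥(ratPoints (tailUnipotent 1 K 0)) (fun _ => (1 : ℝ≥0∞)) x = 1 := by
    intro x
    rw [coveringSum]
    haveI : Subsingleton ↥(ratPoints (n := 1) (K := K) (tailUnipotent 1 K 0)) := by
      refine ⟨fun a b => Subtype.ext ?_⟩
      obtain ⟨u, hu, hua⟩ := (mem_ratPoints_iff _ _).1 a.2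
      obtain ⟨u', hu', hub⟩ := (mem_ratPoints_iff _ _).1 b.2
      rw [tailUnipotent_zero] at hu hu'
      have h1 : u = 1 := upperUnitriangular_fin_one_coe_eq_one ⟨u, hu⟩
      have h2 : u' = 1 := upperUnitriangular_fin_one_coe_eq_one ⟨u', hu'⟩
      rw [← hua, ← hub, h1, h2]
    haveI : Unique ↥(ratPoints (n := 1) (K := K) (tailUnipotent 1 K 0)) := uniqueOfSubsingleton 1
    rw [tsum_eq_single (1 : ↥(ratPoints (tailUnipotent 1 K 0))) fun b hb => absurd (Subsingleton.elim b 1) hb]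
  -- the unfolded integrand pulled back along `det`
  have hdet : Measurable (Matrix.GeneralLinearGroup.det : GL (Fin 1) 𝔸 →* ideleGroup K) :=
    Matrix.GeneralLinearGroup.continuous_det.measurable
  have hpt : ∀ g : GL (Fin 1) 𝔸, whittakerDepth 0 Φ (glCorner 𝔸 (Nat.le_succ 1) g) * Θ g =
      whittakerDepth 0 Φ (glDiagonal 2 𝔸 ![Matrix.GeneralLinearGroup.det g, 1]) *
        ((IdeleClassGroup.ideleNorm K (Matrix.GeneralLinearGroup.det g) : ℝ) : ℂ) ^ (s - 1 / 2) := by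
    intro g
    rw [show glCorner 𝔸 (Nat.le_succ 1) g = glDiagonal 2 𝔸 ![Matrix.GeneralLinearGroup.det g, 1] from
      glCorner_fin_one_eq_glDiagonal g]
    rfl
  have hFc : Continuous fun a : ideleGroup K => whittakerDepth 0 Φ (glDiagonal 2 𝔸 ![a, 1]) *
      ((IdeleClassGroup.ideleNorm K a : ℝ) : ℂ) ^ (s - 1 / 2) := by
    refine ((continuous_whittakerDepth hφc 0).comp ?_).mul ?_
    · refine (continuous_glDiagonal (n := 2) 𝔸).comp (continuous_pi fun i => ?_)
      fin_cases i
      · exact continuous_id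
      · exact continuous_const
    · refine (Complex.continuous_ofReal.comp ?_).cpow continuous_const fun a => Or.inl ?_
      · exact NNReal.continuous_coe.comp (continuous_ideleNorm_holds K)
      · rw [Function.comp_apply, Complex.ofReal_re]
        exact NNReal.coe_pos.2 (pos_iff_ne_zero.2 (ideleNorm_ne_zero a))
  -- absolute convergence on the group
  have hint' : ∫⁻ x, ‖whittakerDepth 0 Φ (glCorner 𝔸 (Nat.le_succ 1) x) * Θ x‖ₑ * (fun _ => (1 : ℝ≥0∞)) x ∂ν < ∞ := by
    simp_rw [mul_one, hpt]
    rw [← lintegral_map_det_fin_one ν hFc.measurable.enorm hdet]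
    exact hint
  have key := integral_whittakerDepth_glCorner_mul_eq (m := 1) (K := K) ν hφ' hΘc.measurable hΘK hβ.measurable
    hβ.2 measurable_const hβ1 hint'
  -- assemble: the group integral of `exists_jpssIntegral_eq_mul_integral_coveringWeight` is that of `key`
  have hR : ∀ g : GL (Fin 1) 𝔸, Φ (glCorner 𝔸 Nat.one_lt_two.le g) *
      invQuot (AdelicGroupData.gl 1 K) (fun _ : (AdelicGroupData.gl 1 K).automorphicQuotient => (1 : ℂ)) g *
        ((((glAbsDet 1 K g : ℝ≥0ˣ) : ℝ≥0) : ℝ) : ℂ) ^ (s - 1 / 2) * ((β g).toReal : ℂ) =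
      Φ (glCorner 𝔸 (Nat.le_succ 1) g) * Θ g * ((β g).toReal : ℂ) := by
    intro g
    rw [show invQuot (AdelicGroupData.gl 1 K) (fun _ : (AdelicGroupData.gl 1 K).automorphicQuotient => (1 : ℂ)) g = 1
      from rfl, mul_one]
  have step1 : (∫ g : GL (Fin 1) 𝔸, Φ (glCorner 𝔸 Nat.one_lt_two.le g) *
      invQuot (AdelicGroupData.gl 1 K) (fun _ : (AdelicGroupData.gl 1 K).automorphicQuotient => (1 : ℂ)) g *
        ((((glAbsDet 1 K g : ℝ≥0ˣ) : ℝ≥0) : ℝ) : ℂ) ^ (s - 1 / 2) * ((β g).toReal : ℂ) ∂ν) =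
      ∫ g : GL (Fin 1) 𝔸, Φ (glCorner 𝔸 (Nat.le_succ 1) g) * Θ g * ((β g).toReal : ℂ) ∂ν :=
    integral_congr_ae (ae_of_all _ hR)
  have step3 : (∫ x : GL (Fin 1) 𝔸, whittakerDepth 0 Φ (glCorner 𝔸 (Nat.le_succ 1) x) * Θ x *
      (((fun _ => (1 : ℝ≥0∞)) x).toReal : ℂ) ∂ν) =
      ∫ a, whittakerDepth 0 Φ (glDiagonal 2 𝔸 ![a, 1]) * ((IdeleClassGroup.ideleNorm K a : ℝ) : ℂ) ^ (s - 1 / 2)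
        ∂(ν.map (Matrix.GeneralLinearGroup.det : GL (Fin 1) 𝔸 →* ideleGroup K)) := by
    rw [integral_map_det_fin_one ν hFc.aestronglyMeasurable hdet]
    refine integral_congr_ae (ae_of_all _ fun x => ?_)
    simp only [ENNReal.toReal_one, Complex.ofReal_one, mul_one]
    exact hpt x
  exact step1.trans (key.symm.trans step3)

end Main

end Literature.NumberTheory.Automorphic
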